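import Mathlib

/-!
# `Balaban1983to89.B13Bound226Numerals` — T. Bałaban, *Renormalization group approach to lattice gauge field theories. II.
Cluster expansions*, Commun. Math. Phys. **116** (1988) 1–22, doi:10.1007/bf01239022 [Balaban1988RG2Cluster], p. 17,
(2.23)–(2.26): **THE (2.24)–(2.26) SMALLNESS OF THE N10 JUNCTION AS LOCATED NUMERALS** — the existential data
`κ″ < κ′ < κ < κ₂ < κ_C⋆` (four exchange rates below the covariance rate), the perturbative letter `ϑ`, and the four
object-dependent smallness hypotheses `hθR1le`, `hsmallKθ`, `hαc` ((2.24)), `hsmall` ((2.25)) of the entrywise junction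
(`Summits/…/BalabanUVNodesN10AtRecord11B13WalksBlockEntrywise` = module 32, at NODE 00's kernel tower
`…/BalabanUVNodesN10B13KernelTowerWalksEntrywise` = «51C») ELIMINATED ∕ DISCHARGED, in their exact binder shapes, from
THREE located numerals of the honest letters: `θ₀ ≤ θ₀max`, `γ₂ ≤ γ₂max`, `M⁴min ≤ M⁴`

statement-level skeleton of published theorems with citation tags; proofs where landed; nothing here is a claim about the
Yang–Mills mass gap

CITATION HEADER (verbatim, PDF held `paper:balaban1988-cmp116-rg-ii-cluster`, journal page = PDF page).  p. 17, after (2.23):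
*"where α₅ = O(1)e^{−⅓δ₀M} + O(α₀ + α₁) + O(1)α₄ + γ₂. It is a Gaussian integral, and can be easily calculated."*; after (2.24):
*"Of course we have assumed that α₅ is sufficiently small, e.g. α₅‖C^{(k)}(Z₀,0)‖ < ½. The factor with the determinants can be
estimated by exp O(1)α₅|Z₀|."* (v1.0.1: «½» is a stacked glyph the text layer garbles as «<\.»; settled from the page image by lit-balaban
r10, bus l.24672 — referee ref-M READ-3 NIT 1; the typed binder `hαc` is the «≤ ½» form); p. 21, closing paragraph: *"The assumptions allow finally us to fix all the constants, or rather
bounds on these constants."*  NOT PRINTED: the explicit thresholds below — print says «sufficiently small»; the numerals are this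
file's bookkeeping of WHAT «sufficiently small» has to mean for the binders AS TYPED in the tree.

WHY THIS FILE (cell `pub-ymgap`, HUMAN RULING D-0062 Track A ∕ D-0149 width seats, node N10 = [B13], seat `pub-ymgap-dag-n10-w1`,
item (A) of the lane owner's brief `HOME/pub-ymgap-dag-n10-c/N10-W-SEAT-BRIEF.md` §3).  In the tower junction «51C»
(`b13LeafOfRecord_layer_of_located_entrywise`, lines ≈ 243–274) the binders
`{KG KCs θ₀} {kap kap' kap'' kap₂ ϑ} hkap'' hk1 hk2 hk3 hk4 hθ₀le hθR1le hsmallKθ {cE} hc0 hcE hαc hsmall` are ∃-DATA plus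
inequalities coupling NODE A's letters (`θ₀`, the fibre bound `m`, the torus dimension `ν`, `K_G ≥ K̄`, `K_Cs ≥ 8∕m_{A,0}`,
`κ_C⋆ = (rf.toWalkPackage R₁).kapCStar`, `B_Γ`, `c_V`, `c₀(1,η)`, `m_{A,0}`, `γ₂`, `m′`) with the record's `c.α₄, c.M, c.κ₁`.
In print these are ONE sentence («α₅ sufficiently small»).  This file makes the sentence a located numeral: it FIXES the chain
canonically and proves that three explicit thresholds imply every one of those binders — pure real analysis over ABSTRACT real
letters, no tree object, so that the lane's corollary edition of 51C ∕ 32 instantiates it by `κ⋆ := (rf.toWalkPackage R₁).kapCStar`,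
`c₀η := B6.c0 1 rf.η`, and (canonically, by `le_rfl`) `K_G := K̄`, `K_Cs := 8∕m_{A,0}`, `c_E := 2∕m_{A,0}`.

THE CHOICES (§1–§2).  Rates `chainRate j κ⋆ := j·κ⋆∕5`, `(κ″, κ′, κ, κ₂) := (chainRate 1, 2, 3, 4)`: every gap the binders read
(`κ − κ′`, `κ′ − κ″`, `κ⋆ − κ₂`, `κ₂ − κ`, and `κ″` itself) equals `κ⋆∕5`, so every fibre factor `m·(1 + 2∕gap)^ν` is the ONE
number `fib m ν κ⋆ := m·(1 + 10∕κ⋆)^ν` (and `m·(1 + 2∕κ)^ν ≤ fib`).  Letter `ϑ := theta := θ₀·(1 + K_Cs·K_G·fib²)²`: then the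
left side of `hθR1le` EQUALS `ϑ − θ₀` (`hθR1le_eq`), so `hθR1le` and `hθ₀le` hold for every `θ₀ ≥ 0` with no condition at all.
THE NUMERALS (§3–§4).  With `u := K_Cs·K_G·fib²`, `Q := K_Cs·fib²·(1+u)²` (`coefQ`), `Q′ := 2·fib·(1+u)²` (`coefQ'`), the `hsmall`
volume factor `V := 1 + 2c_E·(B_Γc_V)(B_Γ·m·c₀η^ν)∕(m_A∕2)` VERBATIM (`volFac`) and `D := c_E + V` (`dSum`):
`θ₀max := 1∕(1 + 2Q + 6DQ′)`, `γ₂max := 1∕(6D)`, `M⁴min := 12·D·(m′·α₄·(1 + 32∕(κ₁−1))⁴)`.  THEN (§3–§4): `hsmallKθ` (indeed its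
left side is `≤ θ₀·Q ≤ ½`), `hαc` and `hsmall` (their common first factor — print's `α₅` — times `D` is `≤ ½`, and `c_E ≤ D`,
`V ≤ D`).  §5: the one term-dependent binder `hvol` FOLLOWS from the θ-FREE count inequality
`2|Λ| + ½|Λ ⊕ C₀| + 2K₀α₄·#⋃𝐃 ≤ a₅|Z|` (`vol_of_counts`).  §6: the thresholds are positive and the three located conditions are
jointly inhabited (`exists_letters`, the A6 rule), and the bundle `numerals_226` lists the eleven binder shapes at once
(`numerals_226_canonical`: the same at the canonical letters `K_G := K̄`, `K_Cs := 8∕m_A`, `c_E := 2∕m_A`).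
WHAT REMAINS DISPLAYED at the junction after this file (with `θ₀ := θ₀max`, `γ₂ := γ₂max`): `hαsmall : α ≤ θ₀max·R₁∕(4K̄+4)`
(the configuration size), `hRσlarge : log((4K̄+4)∕θ₀max)∕(μ∕4 − κ⋆) ≤ R_σ` (ONE lower bound on the far-ness), `hPa : a ≤ γ₂max·r_P²`
(ONE lower bound on `r_P`), `M⁴min ≤ c.M⁴` («M sufficiently large»), and `hvol` in count form.

v1.0.1 (docstring-only; declarations byte-identical): the p. 17 quotation corrected «< 1» → «< ½» (ref-M READ-3 NIT 1, r10 page settle).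

HONEST SCOPE.  Elementary real inequalities repackaging TYPED hypotheses of a landed junction; the `def`s are transparent numerals
(no structure, no instance, no notation, no new named fact, D-0026); nothing of Bałaban's operators, kernels or constants is
constructed or asserted, and no claim is made that Bałaban's constants meet the thresholds (that is the located content of the
remaining displayed hypotheses); count-neutral; N10 NOT discharged; one finite four-torus programme at fixed ε per run; nothing
continuum ∕ ℝ⁴ ∕ OS ∕ mass-gap ∕ Clay.  No `sorry`.
-/

noncomputable section

namespace Literature.MathematicalPhysics.QuantumFieldTheory.Balaban1983to89.B13Bound226Numerals

/-! ## §1. The canonical rate chain below `κ_C⋆` and the common fibre factor -/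

section Chain

variable (m ν : ℕ) (κs : ℝ)

/-- NUMERAL (choice). The canonical equally spaced exchange-rate chain below the covariance rate `κ⋆ = κ_C⋆`:
`chainRate j κ⋆ := j·κ⋆∕5`; the junction's `(κ″, κ′, κ, κ₂)` are `j = 1, 2, 3, 4`. [cite: Balaban1988RG2Cluster, (2.16) p.16 and (2.24) p.17] -/
def chainRate (j : ℕ) (κs : ℝ) : ℝ := j * κs / 5

/-- NUMERAL (choice). The common fibre factor of the canonical chain, `fib m ν κ⋆ := m·(1 + 10∕κ⋆)^ν` (`m` = fibre bound of the
bond locations, `ν` = site-torus dimension): every `m·(1 + 2∕gap)^ν` with `gap = κ⋆∕5`. [cite: Balaban1988RG2Cluster, (2.24) p.17] -/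
def fib (m ν : ℕ) (κs : ℝ) : ℝ := m * (1 + 10 / κs) ^ ν

variable {κs}

/-- `0 < chainRate j κ⋆` for `j ≥ 1`, `κ⋆ > 0`. [cite: Balaban1988RG2Cluster, (2.16) p.16] -/
theorem chainRate_pos (hκ : 0 < κs) {j : ℕ} (hj : 0 < j) : 0 < chainRate j κs := by
  unfold chainRate
  have : (0 : ℝ) < j := Nat.cast_pos.mpr hj
  positivity

/-- Binder `hkap''`: `0 < κ″ = chainRate 1 κ⋆`. [cite: Balaban1988RG2Cluster, (2.16) p.16] -/
theorem chainRate_one_pos (hκ : 0 < κs) : 0 < chainRate 1 κs := chainRate_pos hκ Nat.one_pos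

/-- Consecutive gaps of the chain are `κ⋆∕5`. [cite: Balaban1988RG2Cluster, (2.16) p.16] -/
theorem chainRate_succ_sub (j : ℕ) : chainRate (j + 1) κs - chainRate j κs = κs / 5 := by
  unfold chainRate; push_cast; ring

/-- Binder `hk1`: `κ″ < κ′`. [cite: Balaban1988RG2Cluster, (2.16) p.16] -/
theorem chainRate_one_lt_two (hκ : 0 < κs) : chainRate 1 κs < chainRate 2 κs := by
  unfold chainRate; push_cast; linarith

/-- Binder `hk2`: `κ′ < κ`. [cite: Balaban1988RG2Cluster, (2.16) p.16] -/
theorem chainRate_two_lt_three (hκ : 0 < κs) : chainRate 2 κs < chainRate 3 κs := by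
  unfold chainRate; push_cast; linarith

/-- Binder `hk3`: `κ < κ₂`. [cite: Balaban1988RG2Cluster, (2.16) p.16] -/
theorem chainRate_three_lt_four (hκ : 0 < κs) : chainRate 3 κs < chainRate 4 κs := by
  unfold chainRate; push_cast; linarith

/-- Binder `hk4`: `κ₂ < κ_C⋆`. [cite: Balaban1988RG2Cluster, (2.16) p.16] -/
theorem chainRate_four_lt (hκ : 0 < κs) : chainRate 4 κs < κs := by
  unfold chainRate; push_cast; linarith

/-- The four gaps the junction reads: `κ − κ′ = κ′ − κ″ = κ⋆ − κ₂ = κ₂ − κ = κ⋆∕5`, and `κ″ = κ⋆∕5`. [cite: Balaban1988RG2Cluster, (2.16) p.16] -/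
theorem gaps_eq : chainRate 3 κs - chainRate 2 κs = κs / 5 ∧ chainRate 2 κs - chainRate 1 κs = κs / 5 ∧
    κs - chainRate 4 κs = κs / 5 ∧ chainRate 4 κs - chainRate 3 κs = κs / 5 ∧ chainRate 1 κs = κs / 5 := by
  unfold chainRate; push_cast; refine ⟨by ring, by ring, by ring, by ring, by ring⟩

/-- `0 ≤ fib`. [cite: Balaban1988RG2Cluster, (2.24) p.17] -/
theorem fib_nonneg (hκ : 0 < κs) : 0 ≤ fib m ν κs := by
  unfold fib; positivity

/-- A fibre factor over a gap equal to `κ⋆∕5` is `fib`. [cite: Balaban1988RG2Cluster, (2.24) p.17] -/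
theorem fibFactor_of_eq {x : ℝ} (hx : x = κs / 5) : (m : ℝ) * (1 + 2 / x) ^ ν = fib m ν κs := by
  subst hx
  have h : (1 : ℝ) + 2 / (κs / 5) = 1 + 10 / κs := by rw [div_div_eq_mul_div]; ring
  unfold fib; rw [h]

/-- The fibre factor over `κ − κ′` is `fib`. [cite: Balaban1988RG2Cluster, (2.24) p.17] -/
theorem fibFactor_32 : (m : ℝ) * (1 + 2 / (chainRate 3 κs - chainRate 2 κs)) ^ ν = fib m ν κs :=
  fibFactor_of_eq m ν gaps_eq.1

/-- The fibre factor over `κ′ − κ″` is `fib`. [cite: Balaban1988RG2Cluster, (2.24) p.17] -/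
theorem fibFactor_21 : (m : ℝ) * (1 + 2 / (chainRate 2 κs - chainRate 1 κs)) ^ ν = fib m ν κs :=
  fibFactor_of_eq m ν gaps_eq.2.1

/-- The fibre factor over `κ⋆ − κ₂` is `fib`. [cite: Balaban1988RG2Cluster, (2.24) p.17] -/
theorem fibFactor_4 : (m : ℝ) * (1 + 2 / (κs - chainRate 4 κs)) ^ ν = fib m ν κs :=
  fibFactor_of_eq m ν gaps_eq.2.2.1

/-- The fibre factor over `κ₂ − κ` is `fib`. [cite: Balaban1988RG2Cluster, (2.24) p.17] -/
theorem fibFactor_43 : (m : ℝ) * (1 + 2 / (chainRate 4 κs - chainRate 3 κs)) ^ ν = fib m ν κs :=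
  fibFactor_of_eq m ν gaps_eq.2.2.2.1

/-- The fibre factor over `κ″` is `fib`. [cite: Balaban1988RG2Cluster, (2.24) p.17] -/
theorem fibFactor_1 : (m : ℝ) * (1 + 2 / chainRate 1 κs) ^ ν = fib m ν κs :=
  fibFactor_of_eq m ν gaps_eq.2.2.2.2

/-- The fibre factor over `κ = 3κ⋆∕5` is at most `fib` (and non-negative). [cite: Balaban1988RG2Cluster, (2.24) p.17] -/
theorem fibFactor_3_le (hκ : 0 < κs) :
    0 ≤ (m : ℝ) * (1 + 2 / chainRate 3 κs) ^ ν ∧ (m : ℝ) * (1 + 2 / chainRate 3 κs) ^ ν ≤ fib m ν κs := by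
  have h3 : 0 < chainRate 3 κs := chainRate_pos hκ (by norm_num)
  refine ⟨by positivity, ?_⟩
  unfold fib
  refine mul_le_mul_of_nonneg_left (pow_le_pow_left₀ (by positivity) ?_ ν) (Nat.cast_nonneg m)
  have hle : 2 / chainRate 3 κs ≤ 10 / κs := by
    unfold chainRate; push_cast
    rw [div_le_div_iff₀ (by positivity) hκ]
    nlinarith
  linarith

end Chain

/-! ## §2. The letter `ϑ` and the binders `hθ₀le`, `hθR1le` (EQUALITY) -/

section Theta

variable (m ν : ℕ) (κs KG KCs θ₀ : ℝ)

/-- NUMERAL (choice). The perturbative letter of the junction on the canonical chain,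
`ϑ := theta := θ₀·(1 + K_Cs·K_G·fib²)²` — the left side of `hθR1le` plus `θ₀`. [cite: Balaban1988RG2Cluster, (2.24) p.17] -/
def theta (m ν : ℕ) (κs KG KCs θ₀ : ℝ) : ℝ := θ₀ * (1 + KCs * KG * fib m ν κs ^ 2) ^ 2

variable {KG KCs θ₀}

/-- `0 ≤ ϑ` for `θ₀ ≥ 0`. [cite: Balaban1988RG2Cluster, (2.24) p.17] -/
theorem theta_nonneg (hθ₀ : 0 ≤ θ₀) : 0 ≤ theta m ν κs KG KCs θ₀ := by
  unfold theta; positivity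

/-- Binder `hθ₀le`: `θ₀ ≤ ϑ` (for `K_G, K_Cs, θ₀ ≥ 0`; `κ⋆ > 0`). [cite: Balaban1988RG2Cluster, (2.24) p.17] -/
theorem le_theta (hκ : 0 < κs) (hKG : 0 ≤ KG) (hKCs : 0 ≤ KCs) (hθ₀ : 0 ≤ θ₀) : θ₀ ≤ theta m ν κs KG KCs θ₀ := by
  unfold theta
  have hf := fib_nonneg m ν hκ
  have hu : 0 ≤ KCs * KG * fib m ν κs ^ 2 := by positivity
  have h1 : (1 : ℝ) ≤ (1 + KCs * KG * fib m ν κs ^ 2) ^ 2 := by nlinarith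
  nlinarith

/-- Binder `hθR1le` WITH EQUALITY on the canonical chain (`K_G` for `K̄`, `K_Cs` for `8∕m_{A,0}`, `κ⋆` for `κ_C⋆`): the left side
`F·F·(θ₀K_CsK_G + K_G(K_Csθ₀F·K_CsF)K_G + K_GK_Csθ₀)` equals `ϑ − θ₀`. [cite: Balaban1988RG2Cluster, (2.24) p.17] -/
theorem hθR1le_eq :
    ((m : ℝ) * (1 + 2 / (chainRate 3 κs - chainRate 2 κs)) ^ ν) * ((m : ℝ) * (1 + 2 / (chainRate 2 κs - chainRate 1 κs)) ^ ν)
      * (θ₀ * KCs * KG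
        + KG * (KCs * θ₀ * ((m : ℝ) * (1 + 2 / (κs - chainRate 4 κs)) ^ ν) * KCs
            * ((m : ℝ) * (1 + 2 / (chainRate 4 κs - chainRate 3 κs)) ^ ν)) * KG
        + KG * KCs * θ₀)
      = theta m ν κs KG KCs θ₀ - θ₀ := by
  rw [fibFactor_32, fibFactor_21, fibFactor_4, fibFactor_43]
  unfold theta; ring

/-- Binder `hθR1le` in its exact shape: the left side `≤ ϑ` (for `θ₀ ≥ 0`). [cite: Balaban1988RG2Cluster, (2.24) p.17] -/
theorem hθR1le_numerals (hθ₀ : 0 ≤ θ₀) :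
    ((m : ℝ) * (1 + 2 / (chainRate 3 κs - chainRate 2 κs)) ^ ν) * ((m : ℝ) * (1 + 2 / (chainRate 2 κs - chainRate 1 κs)) ^ ν)
      * (θ₀ * KCs * KG
        + KG * (KCs * θ₀ * ((m : ℝ) * (1 + 2 / (κs - chainRate 4 κs)) ^ ν) * KCs
            * ((m : ℝ) * (1 + 2 / (chainRate 4 κs - chainRate 3 κs)) ^ ν)) * KG
        + KG * KCs * θ₀)
      ≤ theta m ν κs KG KCs θ₀ := by
  rw [hθR1le_eq]; linarith

end Theta

/-! ## §3. The smallness `hsmallKθ`: its left side is `≤ θ₀·Q` -/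

section SmallKTheta

variable (m ν : ℕ) (κs KG KCs θ₀ : ℝ)

/-- NUMERAL. The θ₀-coefficient bounding the left side of `hsmallKθ` on the canonical chain,
`Q := coefQ := K_Cs·fib²·(1 + K_Cs·K_G·fib²)²`. [cite: Balaban1988RG2Cluster, (2.24) p.17] -/
def coefQ (m ν : ℕ) (κs KG KCs : ℝ) : ℝ := KCs * fib m ν κs ^ 2 * (1 + KCs * KG * fib m ν κs ^ 2) ^ 2

variable {κs KG KCs θ₀}

/-- `0 ≤ Q`. [cite: Balaban1988RG2Cluster, (2.24) p.17] -/
theorem coefQ_nonneg (hKCs : 0 ≤ KCs) : 0 ≤ coefQ m ν κs KG KCs := by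
  unfold coefQ; positivity

/-- The left side of `hsmallKθ` on the canonical chain is non-negative and `≤ θ₀·Q`. [cite: Balaban1988RG2Cluster, (2.24) p.17] -/
theorem smallKθ_le (hκ : 0 < κs) (hKCs : 0 ≤ KCs) (hθ₀ : 0 ≤ θ₀) :
    0 ≤ KCs * ((m : ℝ) * (1 + 2 / chainRate 3 κs) ^ ν) * (theta m ν κs KG KCs θ₀ * ((m : ℝ) * (1 + 2 / chainRate 1 κs) ^ ν)) ∧
    KCs * ((m : ℝ) * (1 + 2 / chainRate 3 κs) ^ ν) * (theta m ν κs KG KCs θ₀ * ((m : ℝ) * (1 + 2 / chainRate 1 κs) ^ ν))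
      ≤ θ₀ * coefQ m ν κs KG KCs := by
  obtain ⟨h30, h3⟩ := fibFactor_3_le m ν hκ
  have hθ := theta_nonneg m ν κs (KG := KG) (KCs := KCs) hθ₀
  have hf := fib_nonneg m ν hκ
  rw [fibFactor_1]
  refine ⟨by positivity, ?_⟩
  calc KCs * ((m : ℝ) * (1 + 2 / chainRate 3 κs) ^ ν) * (theta m ν κs KG KCs θ₀ * fib m ν κs)
      ≤ KCs * fib m ν κs * (theta m ν κs KG KCs θ₀ * fib m ν κs) :=
        mul_le_mul_of_nonneg_right (mul_le_mul_of_nonneg_left h3 hKCs) (by positivity)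
    _ = θ₀ * coefQ m ν κs KG KCs := by unfold theta coefQ; ring

end SmallKTheta

/-! ## §4. The three located numerals and the binders `hsmallKθ`, `hαc` ((2.24)), `hsmall` ((2.25)) -/

section Numerals

variable (m ν m' : ℕ) (κs KG KCs θ₀ cE BΓ cV c0η mA γ₂ α₄ M κ₁ : ℝ)

/-- NUMERAL. The θ₀-coefficient of the perturbative part of print's `α₅` on the canonical chain: `2·ϑ·F″ = θ₀·Q′` with
`Q′ := coefQ' := 2·fib·(1 + K_Cs·K_G·fib²)²`. [cite: Balaban1988RG2Cluster, (2.23)-(2.24) p.17] -/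
def coefQ' (m ν : ℕ) (κs KG KCs : ℝ) : ℝ := 2 * (1 + KCs * KG * fib m ν κs ^ 2) ^ 2 * fib m ν κs

/-- NUMERAL (verbatim shape). The volume factor of the (2.25) binder `hsmall`:
`V := volFac := 1 + 2c_E·((B_Γ·c_V)·(B_Γ·(m·c₀η^ν)))∕(m_A∕2)` — `c_E` the eigenvalue bound of the covariance (`≥ 2∕m_{A,0}`),
`B_Γ²c_V·m·c₀(1,η)^ν∕(m_{A,0}∕2)` the form bound of `Γ₀`. [cite: Balaban1988RG2Cluster, (2.25) p.17] -/
def volFac (m ν : ℕ) (cE BΓ cV c0η mA : ℝ) : ℝ := 1 + 2 * cE * (BΓ * cV * (BΓ * (m * c0η ^ ν)) / (mA / 2))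

/-- NUMERAL. `D := dSum := c_E + V`, a common upper bound of the two second factors of (2.24) ∕ (2.25).
[cite: Balaban1988RG2Cluster, (2.24)-(2.25) p.17] -/
def dSum (m ν : ℕ) (cE BΓ cV c0η mA : ℝ) : ℝ := cE + volFac m ν cE BΓ cV c0η mA

/-- **LOCATED NUMERAL 1: the threshold for `θ₀`**, `θ₀max := 1∕(1 + 2Q + 6DQ′)` — what «O(1)e^{−⅓δ₀M} + O(α₀ + α₁) sufficiently
small» has to mean for the binders `hsmallKθ`, `hαc`, `hsmall` as typed. [cite: Balaban1988RG2Cluster, (2.24) p.17] -/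
def theta0Max (m ν : ℕ) (κs KG KCs cE BΓ cV c0η mA : ℝ) : ℝ :=
  1 / (1 + 2 * coefQ m ν κs KG KCs + 6 * dSum m ν cE BΓ cV c0η mA * coefQ' m ν κs KG KCs)

/-- **LOCATED NUMERAL 2: the threshold for `γ₂`**, `γ₂max := 1∕(6D)` — what «γ₂ is a small, positive constant» (p. 16, after (2.22))
has to mean for `hαc`, `hsmall` as typed. [cite: Balaban1988RG2Cluster, (2.22) p.16 and (2.24) p.17] -/
def gamma2Max (m ν : ℕ) (cE BΓ cV c0η mA : ℝ) : ℝ := 1 / (6 * dSum m ν cE BΓ cV c0η mA)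

/-- **LOCATED NUMERAL 3: the threshold for `M⁴`**, `M⁴min := 12·D·(m′·α₄·(1 + 32∕(κ₁−1))⁴)` — what «O(1)α₄» small (the tree's
`a₂₀ = 2m′α₄M⁻⁴(1 + 32∕(κ₁−1))⁴`) has to mean for `hαc`, `hsmall` as typed. [cite: Balaban1988RG2Cluster, (2.20) p.16 and (2.24) p.17] -/
def m4Min (m ν m' : ℕ) (cE BΓ cV c0η mA α₄ κ₁ : ℝ) : ℝ :=
  12 * dSum m ν cE BΓ cV c0η mA * (m' * α₄ * (1 + 32 / (κ₁ - 1)) ^ 4)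

variable {κs KG KCs θ₀ cE BΓ cV c0η mA γ₂ α₄ M κ₁}

/-- `0 ≤ Q′`. [cite: Balaban1988RG2Cluster, (2.24) p.17] -/
theorem coefQ'_nonneg (hκ : 0 < κs) : 0 ≤ coefQ' m ν κs KG KCs := by
  unfold coefQ'; have := fib_nonneg m ν hκ; positivity

/-- `2·ϑ·F″ = θ₀·Q′` on the canonical chain. [cite: Balaban1988RG2Cluster, (2.24) p.17] -/
theorem two_theta_fib_eq :
    2 * (theta m ν κs KG KCs θ₀ * ((m : ℝ) * (1 + 2 / chainRate 1 κs) ^ ν)) = θ₀ * coefQ' m ν κs KG KCs := by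
  rw [fibFactor_1]; unfold theta coefQ'; ring

/-- `1 ≤ V`: the volume factor is at least one (for `c_E, c_V, c₀η ≥ 0`, `m_A > 0`). [cite: Balaban1988RG2Cluster, (2.25) p.17] -/
theorem one_le_volFac (hcE : 0 ≤ cE) (hcV : 0 ≤ cV) (hc0 : 0 ≤ c0η) (hmA : 0 < mA) : 1 ≤ volFac m ν cE BΓ cV c0η mA := by
  unfold volFac
  have h : 0 ≤ BΓ * cV * (BΓ * (m * c0η ^ ν)) := by
    have : BΓ * cV * (BΓ * (m * c0η ^ ν)) = BΓ ^ 2 * (cV * (m * c0η ^ ν)) := by ring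
    rw [this]; positivity
  have h' : 0 ≤ 2 * cE * (BΓ * cV * (BΓ * (m * c0η ^ ν)) / (mA / 2)) := by positivity
  linarith

/-- `0 < D`, `c_E ≤ D`, `V ≤ D`. [cite: Balaban1988RG2Cluster, (2.24)-(2.25) p.17] -/
theorem dSum_pos_and_le (hcE : 0 ≤ cE) (hcV : 0 ≤ cV) (hc0 : 0 ≤ c0η) (hmA : 0 < mA) :
    0 < dSum m ν cE BΓ cV c0η mA ∧ cE ≤ dSum m ν cE BΓ cV c0η mA ∧
      volFac m ν cE BΓ cV c0η mA ≤ dSum m ν cE BΓ cV c0η mA := by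
  have h1 := one_le_volFac m ν (BΓ := BΓ) hcE hcV hc0 hmA
  unfold dSum
  exact ⟨by linarith, by linarith, by linarith⟩

/-- `0 < θ₀max`. [cite: Balaban1988RG2Cluster, (2.24) p.17] -/
theorem theta0Max_pos (hκ : 0 < κs) (hKCs : 0 ≤ KCs) (hcE : 0 ≤ cE) (hcV : 0 ≤ cV) (hc0 : 0 ≤ c0η) (hmA : 0 < mA) :
    0 < theta0Max m ν κs KG KCs cE BΓ cV c0η mA := by
  unfold theta0Max
  have hQ := coefQ_nonneg m ν (κs := κs) (KG := KG) hKCs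
  have hQ' := coefQ'_nonneg m ν (KG := KG) (KCs := KCs) hκ
  have hD := (dSum_pos_and_le m ν (BΓ := BΓ) hcE hcV hc0 hmA).1
  positivity

/-- `0 < γ₂max`. [cite: Balaban1988RG2Cluster, (2.22) p.16] -/
theorem gamma2Max_pos (hcE : 0 ≤ cE) (hcV : 0 ≤ cV) (hc0 : 0 ≤ c0η) (hmA : 0 < mA) :
    0 < gamma2Max m ν cE BΓ cV c0η mA := by
  unfold gamma2Max
  have hD := (dSum_pos_and_le m ν (BΓ := BΓ) hcE hcV hc0 hmA).1
  positivity

/-- `0 ≤ M⁴min` (for `α₄ ≥ 0`). [cite: Balaban1988RG2Cluster, (2.20) p.16] -/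
theorem m4Min_nonneg (hcE : 0 ≤ cE) (hcV : 0 ≤ cV) (hc0 : 0 ≤ c0η) (hmA : 0 < mA) (hα₄ : 0 ≤ α₄) :
    0 ≤ m4Min m ν m' cE BΓ cV c0η mA α₄ κ₁ := by
  unfold m4Min
  have hD := (dSum_pos_and_le m ν (BΓ := BΓ) hcE hcV hc0 hmA).1
  have hJ : 0 ≤ (1 + 32 / (κ₁ - 1)) ^ 4 := by positivity
  positivity

/-- Under `θ₀ ≤ θ₀max`: `θ₀·Q ≤ ½` and `θ₀·Q′·D ≤ ⅙`. [cite: Balaban1988RG2Cluster, (2.24) p.17] -/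
theorem theta0_mul_le (hκ : 0 < κs) (hKCs : 0 ≤ KCs) (hθ₀ : 0 ≤ θ₀) (hcE : 0 ≤ cE) (hcV : 0 ≤ cV) (hc0 : 0 ≤ c0η)
    (hmA : 0 < mA) (hle : θ₀ ≤ theta0Max m ν κs KG KCs cE BΓ cV c0η mA) :
    θ₀ * coefQ m ν κs KG KCs ≤ 1 / 2 ∧ θ₀ * coefQ' m ν κs KG KCs * dSum m ν cE BΓ cV c0η mA ≤ 1 / 6 := by
  have hQ := coefQ_nonneg m ν (κs := κs) (KG := KG) hKCs
  have hQ' := coefQ'_nonneg m ν (KG := KG) (KCs := KCs) hκ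
  have hD := (dSum_pos_and_le m ν (BΓ := BΓ) hcE hcV hc0 hmA).1
  set Q := coefQ m ν κs KG KCs
  set Q' := coefQ' m ν κs KG KCs
  set D := dSum m ν cE BΓ cV c0η mA
  have hden : 0 < 1 + 2 * Q + 6 * D * Q' := by positivity
  have hθle : θ₀ ≤ 1 / (1 + 2 * Q + 6 * D * Q') := hle
  have hkey : θ₀ * (1 + 2 * Q + 6 * D * Q') ≤ 1 := by
    calc θ₀ * (1 + 2 * Q + 6 * D * Q') ≤ 1 / (1 + 2 * Q + 6 * D * Q') * (1 + 2 * Q + 6 * D * Q') :=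
          mul_le_mul_of_nonneg_right hθle hden.le
      _ = 1 := by field_simp
  constructor
  · nlinarith [mul_nonneg hθ₀ hQ, mul_nonneg hθ₀ (mul_nonneg hD.le hQ')]
  · nlinarith [mul_nonneg hθ₀ hQ, mul_nonneg hθ₀ (mul_nonneg hD.le hQ')]

/-- **Binder `hsmallKθ`** from LOCATED NUMERAL 1: `K_Cs·(m(1+2∕κ)^ν)·(ϑ·(m(1+2∕κ″)^ν)) < 1` — indeed `≤ ½`, which is also
what `hvol`'s factor `(1 − ·)⁻¹` wants. [cite: Balaban1988RG2Cluster, (2.24) p.17] -/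
theorem hsmallKθ_numerals (hκ : 0 < κs) (hKCs : 0 ≤ KCs) (hθ₀ : 0 ≤ θ₀) (hcE : 0 ≤ cE) (hcV : 0 ≤ cV)
    (hc0 : 0 ≤ c0η) (hmA : 0 < mA) (hle : θ₀ ≤ theta0Max m ν κs KG KCs cE BΓ cV c0η mA) :
    KCs * ((m : ℝ) * (1 + 2 / chainRate 3 κs) ^ ν) * (theta m ν κs KG KCs θ₀ * ((m : ℝ) * (1 + 2 / chainRate 1 κs) ^ ν))
        ≤ 1 / 2 ∧
      KCs * ((m : ℝ) * (1 + 2 / chainRate 3 κs) ^ ν) * (theta m ν κs KG KCs θ₀ * ((m : ℝ) * (1 + 2 / chainRate 1 κs) ^ ν))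
        < 1 := by
  have h := (smallKθ_le m ν (KG := KG) hκ hKCs hθ₀).2
  have h' := (theta0_mul_le m ν (KG := KG) (BΓ := BΓ) hκ hKCs hθ₀ hcE hcV hc0 hmA hle).1
  exact ⟨h.trans h', (h.trans h').trans_lt (by norm_num)⟩

/-- Print's `α₅` on the canonical chain — the common first factor of `hαc` ∕ `hsmall`,
`2ϑF″ + (γ₂ + 2m′α₄M⁻⁴(1 + 32∕(κ₁−1))⁴)` — is non-negative and `α₅·D ≤ ½` under the three located numerals.
[cite: Balaban1988RG2Cluster, (2.23)-(2.24) p.17] -/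
theorem alpha5_mul_dSum_le (hκ : 0 < κs) (hKCs : 0 ≤ KCs) (hθ₀ : 0 ≤ θ₀) (hcE : 0 ≤ cE) (hcV : 0 ≤ cV)
    (hc0 : 0 ≤ c0η) (hmA : 0 < mA) (hγ₂ : 0 ≤ γ₂) (hα₄ : 0 ≤ α₄) (hM : 1 ≤ M)
    (hθle : θ₀ ≤ theta0Max m ν κs KG KCs cE BΓ cV c0η mA) (hγle : γ₂ ≤ gamma2Max m ν cE BΓ cV c0η mA)
    (hM4 : m4Min m ν m' cE BΓ cV c0η mA α₄ κ₁ ≤ M ^ 4) :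
    0 ≤ 2 * (theta m ν κs KG KCs θ₀ * ((m : ℝ) * (1 + 2 / chainRate 1 κs) ^ ν))
        + (γ₂ + 2 * ((m' : ℝ) * α₄ * (M ^ 4)⁻¹ * (1 + 32 / (κ₁ - 1)) ^ 4)) ∧
      (2 * (theta m ν κs KG KCs θ₀ * ((m : ℝ) * (1 + 2 / chainRate 1 κs) ^ ν))
        + (γ₂ + 2 * ((m' : ℝ) * α₄ * (M ^ 4)⁻¹ * (1 + 32 / (κ₁ - 1)) ^ 4))) * dSum m ν cE BΓ cV c0η mA ≤ 1 / 2 := by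
  have hQ' := coefQ'_nonneg m ν (KG := KG) (KCs := KCs) hκ
  obtain ⟨hD, -, -⟩ := dSum_pos_and_le m ν (BΓ := BΓ) hcE hcV hc0 hmA
  have hθQ' := (theta0_mul_le m ν (KG := KG) (BΓ := BΓ) hκ hKCs hθ₀ hcE hcV hc0 hmA hθle).2
  set D := dSum m ν cE BΓ cV c0η mA with hD_def
  have hJ : 0 ≤ (1 + 32 / (κ₁ - 1)) ^ 4 := by positivity
  have hM4pos : 0 < M ^ 4 := by positivity
  set J := (1 + 32 / (κ₁ - 1)) ^ 4
  -- the three pieces, each `· D ≤ 1/6`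
  rw [two_theta_fib_eq]
  have hT0 : 0 ≤ 2 * ((m' : ℝ) * α₄ * (M ^ 4)⁻¹ * J) := by positivity
  have hγD : γ₂ * D ≤ 1 / 6 := by
    have h6 : 0 < 6 * D := by positivity
    calc γ₂ * D ≤ 1 / (6 * D) * D := mul_le_mul_of_nonneg_right hγle hD.le
      _ = 1 / 6 := by field_simp
  have hTD : 2 * ((m' : ℝ) * α₄ * (M ^ 4)⁻¹ * J) * D ≤ 1 / 6 := by
    have hM4' : 12 * D * ((m' : ℝ) * α₄ * J) ≤ M ^ 4 := hM4
    rw [show 2 * ((m' : ℝ) * α₄ * (M ^ 4)⁻¹ * J) * D = (12 * D * ((m' : ℝ) * α₄ * J)) / M ^ 4 / 6 by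
      field_simp; ring]
    rw [div_le_iff₀ (by norm_num : (0 : ℝ) < 6), div_le_iff₀ hM4pos]
    linarith
  refine ⟨by positivity, ?_⟩
  nlinarith [mul_nonneg hθ₀ hQ', mul_nonneg hγ₂ hD.le, mul_nonneg hT0 hD.le]

/-- **Binder `hαc` — the (2.24) smallness «α₅‖C(Z₀,0)‖ ≤ ½»** from the three located numerals:
`(2ϑ(m(1+2∕κ″)^ν) + (γ₂ + 2(m′α₄(M⁴)⁻¹(1+32∕(κ₁−1))⁴)))·c_E ≤ ½`. [cite: Balaban1988RG2Cluster, (2.24) p.17] -/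
theorem hαc_numerals (hκ : 0 < κs) (hKCs : 0 ≤ KCs) (hθ₀ : 0 ≤ θ₀) (hcE : 0 ≤ cE) (hcV : 0 ≤ cV)
    (hc0 : 0 ≤ c0η) (hmA : 0 < mA) (hγ₂ : 0 ≤ γ₂) (hα₄ : 0 ≤ α₄) (hM : 1 ≤ M)
    (hθle : θ₀ ≤ theta0Max m ν κs KG KCs cE BΓ cV c0η mA) (hγle : γ₂ ≤ gamma2Max m ν cE BΓ cV c0η mA)
    (hM4 : m4Min m ν m' cE BΓ cV c0η mA α₄ κ₁ ≤ M ^ 4) :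
    (2 * (theta m ν κs KG KCs θ₀ * ((m : ℝ) * (1 + 2 / chainRate 1 κs) ^ ν))
        + (γ₂ + 2 * ((m' : ℝ) * α₄ * (M ^ 4)⁻¹ * (1 + 32 / (κ₁ - 1)) ^ 4))) * cE ≤ 1 / 2 := by
  obtain ⟨h0, h⟩ := alpha5_mul_dSum_le m ν m' (KG := KG) hκ hKCs hθ₀ hcE hcV hc0 hmA hγ₂ hα₄ hM hθle hγle hM4
  obtain ⟨-, hcD, -⟩ := dSum_pos_and_le m ν (BΓ := BΓ) hcE hcV hc0 hmA
  exact (mul_le_mul_of_nonneg_left hcD h0).trans h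

/-- **Binder `hsmall` — the (2.25) smallness with the `Γ₀` volume factor** from the three located numerals:
`α₅·(1 + 2c_E·((B_Γc_V)(B_Γ(m·c₀η^ν)))∕(m_A∕2)) ≤ ½`, the second factor VERBATIM. [cite: Balaban1988RG2Cluster, (2.25) p.17] -/
theorem hsmall_numerals (hκ : 0 < κs) (hKCs : 0 ≤ KCs) (hθ₀ : 0 ≤ θ₀) (hcE : 0 ≤ cE) (hcV : 0 ≤ cV)
    (hc0 : 0 ≤ c0η) (hmA : 0 < mA) (hγ₂ : 0 ≤ γ₂) (hα₄ : 0 ≤ α₄) (hM : 1 ≤ M)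
    (hθle : θ₀ ≤ theta0Max m ν κs KG KCs cE BΓ cV c0η mA) (hγle : γ₂ ≤ gamma2Max m ν cE BΓ cV c0η mA)
    (hM4 : m4Min m ν m' cE BΓ cV c0η mA α₄ κ₁ ≤ M ^ 4) :
    (2 * (theta m ν κs KG KCs θ₀ * ((m : ℝ) * (1 + 2 / chainRate 1 κs) ^ ν))
        + (γ₂ + 2 * ((m' : ℝ) * α₄ * (M ^ 4)⁻¹ * (1 + 32 / (κ₁ - 1)) ^ 4)))
      * (1 + 2 * cE * (BΓ * cV * (BΓ * ((m : ℝ) * c0η ^ ν)) / (mA / 2))) ≤ 1 / 2 := by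
  obtain ⟨h0, h⟩ := alpha5_mul_dSum_le m ν m' (KG := KG) hκ hKCs hθ₀ hcE hcV hc0 hmA hγ₂ hα₄ hM hθle hγle hM4
  obtain ⟨-, -, hVD⟩ := dSum_pos_and_le m ν (BΓ := BΓ) hcE hcV hc0 hmA
  exact (mul_le_mul_of_nonneg_left hVD h0).trans h

end Numerals

/-! ## §5. The term-dependent binder `hvol` from a θ-FREE count inequality -/

section Volume

variable (m ν m' : ℕ) {κs KG KCs θ₀ cE BΓ cV c0η mA γ₂ α₄ M κ₁ : ℝ}

/-- **Binder `hvol` at one term from the count inequality `2|Λ| + ½|Λ ⊕ C₀| + 2K₀α₄·#⋃𝐃 ≤ a₅|Z|`.**  Under the three located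
numerals the θ-dependent coefficients of `hvol` are universal numbers: the determinant factor's coefficient
`2·(x(1 + (1−x)⁻¹)∕2) ≤ 3∕2` (`x` = the left side of `hsmallKθ`, `≤ ½`), `α₅c_E ≤ ½`, `α₅V ≤ ½`; so `hvol`'s left side is at most
`2|Λ| + ½|Λ ⊕ C₀| + 2K₀α₄·#⋃𝐃` (`Λc`, `ΛCc` the two cardinalities as reals, `Uc` the block count, `Zc = |Z|`, `K0` for
`K₀(64,8)`). [cite: Balaban1988RG2Cluster, (2.24)-(2.26) p.17] -/
theorem vol_of_counts (hκ : 0 < κs) (hKCs : 0 ≤ KCs) (hθ₀ : 0 ≤ θ₀) (hcE : 0 ≤ cE) (hcV : 0 ≤ cV)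
    (hc0 : 0 ≤ c0η) (hmA : 0 < mA) (hγ₂ : 0 ≤ γ₂) (hα₄ : 0 ≤ α₄) (hM : 1 ≤ M)
    (hθle : θ₀ ≤ theta0Max m ν κs KG KCs cE BΓ cV c0η mA) (hγle : γ₂ ≤ gamma2Max m ν cE BΓ cV c0η mA)
    (hM4 : m4Min m ν m' cE BΓ cV c0η mA α₄ κ₁ ≤ M ^ 4)
    {K0 a₅ Λc ΛCc Uc Zc : ℝ} (hΛc : 0 ≤ Λc) (hΛCc : 0 ≤ ΛCc)
    (hcount : 2 * Λc + ΛCc / 2 + 2 * (K0 * α₄ * Uc) ≤ a₅ * Zc) :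
    2 * (KCs * ((m : ℝ) * (1 + 2 / chainRate 3 κs) ^ ν) * (theta m ν κs KG KCs θ₀ * ((m : ℝ) * (1 + 2 / chainRate 1 κs) ^ ν))
            * (1 + (1 - KCs * ((m : ℝ) * (1 + 2 / chainRate 3 κs) ^ ν)
              * (theta m ν κs KG KCs θ₀ * ((m : ℝ) * (1 + 2 / chainRate 1 κs) ^ ν)))⁻¹) / 2) * Λc
        + 2 * (K0 * α₄ * Uc)
        + (2 * (theta m ν κs KG KCs θ₀ * ((m : ℝ) * (1 + 2 / chainRate 1 κs) ^ ν))
            + (γ₂ + 2 * ((m' : ℝ) * α₄ * (M ^ 4)⁻¹ * (1 + 32 / (κ₁ - 1)) ^ 4))) * cE * Λc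
        + (2 * (theta m ν κs KG KCs θ₀ * ((m : ℝ) * (1 + 2 / chainRate 1 κs) ^ ν))
            + (γ₂ + 2 * ((m' : ℝ) * α₄ * (M ^ 4)⁻¹ * (1 + 32 / (κ₁ - 1)) ^ 4)))
            * (1 + 2 * cE * (BΓ * cV * (BΓ * ((m : ℝ) * c0η ^ ν)) / (mA / 2))) * ΛCc
      ≤ a₅ * Zc := by
  obtain ⟨hx0, -⟩ := smallKθ_le m ν (KG := KG) hκ hKCs hθ₀
  obtain ⟨hxh, -⟩ := hsmallKθ_numerals m ν (KG := KG) (BΓ := BΓ) hκ hKCs hθ₀ hcE hcV hc0 hmA hθle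
  have hαc := hαc_numerals m ν m' (KG := KG) hκ hKCs hθ₀ hcE hcV hc0 hmA hγ₂ hα₄ hM hθle hγle hM4
  have hsm := hsmall_numerals m ν m' (KG := KG) hκ hKCs hθ₀ hcE hcV hc0 hmA hγ₂ hα₄ hM hθle hγle hM4
  set x := KCs * ((m : ℝ) * (1 + 2 / chainRate 3 κs) ^ ν)
    * (theta m ν κs KG KCs θ₀ * ((m : ℝ) * (1 + 2 / chainRate 1 κs) ^ ν)) with hx_def
  set A := (2 * (theta m ν κs KG KCs θ₀ * ((m : ℝ) * (1 + 2 / chainRate 1 κs) ^ ν))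
    + (γ₂ + 2 * ((m' : ℝ) * α₄ * (M ^ 4)⁻¹ * (1 + 32 / (κ₁ - 1)) ^ 4))) with hA_def
  -- the determinant coefficient
  have hinv : (1 - x)⁻¹ ≤ 2 := by
    calc (1 - x)⁻¹ ≤ (1 / 2 : ℝ)⁻¹ := inv_anti₀ (by norm_num) (by linarith)
      _ = 2 := by norm_num
  have hcoef : 2 * (x * (1 + (1 - x)⁻¹) / 2) ≤ 3 / 2 := by
    have : x * (1 + (1 - x)⁻¹) ≤ 1 / 2 * 3 :=
      mul_le_mul hxh (by linarith) (by have := inv_nonneg.mpr (show (0:ℝ) ≤ 1 - x by linarith); linarith) (by norm_num)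
    linarith
  have h1 : 2 * (x * (1 + (1 - x)⁻¹) / 2) * Λc ≤ 3 / 2 * Λc := mul_le_mul_of_nonneg_right hcoef hΛc
  have h3 : A * cE * Λc ≤ 1 / 2 * Λc := mul_le_mul_of_nonneg_right hαc hΛc
  have h4 : A * (1 + 2 * cE * (BΓ * cV * (BΓ * ((m : ℝ) * c0η ^ ν)) / (mA / 2))) * ΛCc ≤ 1 / 2 * ΛCc :=
    mul_le_mul_of_nonneg_right hsm hΛCc
  linarith

end Volume

/-! ## §6. Non-vacuity of the three located conditions (A6) and the bundle -/

section Bundle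

variable (m ν m' : ℕ) {κs KG KCs θ₀ cE BΓ cV c0η mA γ₂ α₄ M κ₁ : ℝ}

/-- **A6: the three located conditions are jointly inhabited** — `θ₀ := θ₀max > 0`, `γ₂ := γ₂max > 0`, `M := 1 + M⁴min ≥ 1` —
for every choice of the honest letters with their signs. [cite: Balaban1988RG2Cluster, p.21 (closing paragraph)] -/
theorem exists_letters (hκ : 0 < κs) (hKCs : 0 ≤ KCs) (hcE : 0 ≤ cE) (hcV : 0 ≤ cV) (hc0 : 0 ≤ c0η) (hmA : 0 < mA)
    (hα₄ : 0 ≤ α₄) :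
    ∃ θ₀ γ₂ M : ℝ, 0 < θ₀ ∧ θ₀ ≤ theta0Max m ν κs KG KCs cE BΓ cV c0η mA ∧ 0 < γ₂ ∧ γ₂ ≤ gamma2Max m ν cE BΓ cV c0η mA ∧
      1 ≤ M ∧ m4Min m ν m' cE BΓ cV c0η mA α₄ κ₁ ≤ M ^ 4 := by
  have hx := m4Min_nonneg m ν m' (BΓ := BΓ) (κ₁ := κ₁) hcE hcV hc0 hmA hα₄
  refine ⟨_, _, 1 + m4Min m ν m' cE BΓ cV c0η mA α₄ κ₁, theta0Max_pos m ν (KG := KG) (BΓ := BΓ) hκ hKCs hcE hcV hc0 hmA,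
    le_rfl, gamma2Max_pos m ν (BΓ := BΓ) hcE hcV hc0 hmA, le_rfl, by linarith, ?_⟩
  have hB := one_add_mul_le_pow (a := m4Min m ν m' cE BΓ cV c0η mA α₄ κ₁) (by linarith) 4
  push_cast at hB
  linarith

/-- **THE BUNDLE: the eleven binder shapes of the junction at once** — `hkap'' hk1 hk2 hk3 hk4 hθ₀le hθR1le hsmallKθ hαc hsmall`
(and `0 ≤ c_E`) on the canonical chain `(κ″,κ′,κ,κ₂) := chainRate 1∕2∕3∕4 κ⋆`, `ϑ := theta`, under the three located numerals
`θ₀ ≤ θ₀max`, `γ₂ ≤ γ₂max`, `M⁴min ≤ M⁴`. [cite: Balaban1988RG2Cluster, (2.24)-(2.25) p.17] -/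
theorem numerals_226 (hκ : 0 < κs) (hKG : 0 ≤ KG) (hKCs : 0 ≤ KCs) (hθ₀ : 0 ≤ θ₀) (hcE : 0 ≤ cE) (hcV : 0 ≤ cV)
    (hc0 : 0 ≤ c0η) (hmA : 0 < mA) (hγ₂ : 0 ≤ γ₂) (hα₄ : 0 ≤ α₄) (hM : 1 ≤ M)
    (hθle : θ₀ ≤ theta0Max m ν κs KG KCs cE BΓ cV c0η mA) (hγle : γ₂ ≤ gamma2Max m ν cE BΓ cV c0η mA)
    (hM4 : m4Min m ν m' cE BΓ cV c0η mA α₄ κ₁ ≤ M ^ 4) :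
    0 < chainRate 1 κs ∧ chainRate 1 κs < chainRate 2 κs ∧ chainRate 2 κs < chainRate 3 κs ∧
    chainRate 3 κs < chainRate 4 κs ∧ chainRate 4 κs < κs ∧
    θ₀ ≤ theta m ν κs KG KCs θ₀ ∧
    ((m : ℝ) * (1 + 2 / (chainRate 3 κs - chainRate 2 κs)) ^ ν) * ((m : ℝ) * (1 + 2 / (chainRate 2 κs - chainRate 1 κs)) ^ ν)
      * (θ₀ * KCs * KG
        + KG * (KCs * θ₀ * ((m : ℝ) * (1 + 2 / (κs - chainRate 4 κs)) ^ ν) * KCs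
            * ((m : ℝ) * (1 + 2 / (chainRate 4 κs - chainRate 3 κs)) ^ ν)) * KG
        + KG * KCs * θ₀)
      ≤ theta m ν κs KG KCs θ₀ ∧
    KCs * ((m : ℝ) * (1 + 2 / chainRate 3 κs) ^ ν) * (theta m ν κs KG KCs θ₀ * ((m : ℝ) * (1 + 2 / chainRate 1 κs) ^ ν))
      < 1 ∧
    0 ≤ cE ∧
    (2 * (theta m ν κs KG KCs θ₀ * ((m : ℝ) * (1 + 2 / chainRate 1 κs) ^ ν))
        + (γ₂ + 2 * ((m' : ℝ) * α₄ * (M ^ 4)⁻¹ * (1 + 32 / (κ₁ - 1)) ^ 4))) * cE ≤ 1 / 2 ∧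
    (2 * (theta m ν κs KG KCs θ₀ * ((m : ℝ) * (1 + 2 / chainRate 1 κs) ^ ν))
        + (γ₂ + 2 * ((m' : ℝ) * α₄ * (M ^ 4)⁻¹ * (1 + 32 / (κ₁ - 1)) ^ 4)))
      * (1 + 2 * cE * (BΓ * cV * (BΓ * ((m : ℝ) * c0η ^ ν)) / (mA / 2))) ≤ 1 / 2 :=
  ⟨chainRate_one_pos hκ, chainRate_one_lt_two hκ, chainRate_two_lt_three hκ, chainRate_three_lt_four hκ,
    chainRate_four_lt hκ, le_theta m ν κs hκ hKG hKCs hθ₀, hθR1le_numerals m ν κs hθ₀,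
    (hsmallKθ_numerals m ν (KG := KG) (BΓ := BΓ) hκ hKCs hθ₀ hcE hcV hc0 hmA hθle).2, hcE,
    hαc_numerals m ν m' (KG := KG) hκ hKCs hθ₀ hcE hcV hc0 hmA hγ₂ hα₄ hM hθle hγle hM4,
    hsmall_numerals m ν m' (KG := KG) hκ hKCs hθ₀ hcE hcV hc0 hmA hγ₂ hα₄ hM hθle hγle hM4⟩


/-- **THE BUNDLE AT THE CANONICAL LETTERS `K_G := K̄`, `K_Cs := 8∕m_A`, `c_E := 2∕m_A`** (the junction's `hKG`, `hKCs`, `hcE` then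
read `le_rfl`): the three located numerals become functions of `(m, ν, m′, κ⋆, K̄, m_A, B_Γ, c_V, c₀η, α₄, κ₁)` alone — the
largest `θ₀max`, hence the weakest remaining displayed conditions `hαsmall`, `hRσlarge`. [cite: Balaban1988RG2Cluster, (2.24)-(2.25) p.17] -/
theorem numerals_226_canonical {Kbar : ℝ} (hκ : 0 < κs) (hKbar : 0 ≤ Kbar) (hθ₀ : 0 ≤ θ₀) (hcV : 0 ≤ cV) (hc0 : 0 ≤ c0η)
    (hmA : 0 < mA) (hγ₂ : 0 ≤ γ₂) (hα₄ : 0 ≤ α₄) (hM : 1 ≤ M)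
    (hθle : θ₀ ≤ theta0Max m ν κs Kbar (8 / mA) (2 / mA) BΓ cV c0η mA)
    (hγle : γ₂ ≤ gamma2Max m ν (2 / mA) BΓ cV c0η mA) (hM4 : m4Min m ν m' (2 / mA) BΓ cV c0η mA α₄ κ₁ ≤ M ^ 4) :
    0 < chainRate 1 κs ∧ chainRate 1 κs < chainRate 2 κs ∧ chainRate 2 κs < chainRate 3 κs ∧
    chainRate 3 κs < chainRate 4 κs ∧ chainRate 4 κs < κs ∧
    θ₀ ≤ theta m ν κs Kbar (8 / mA) θ₀ ∧
    ((m : ℝ) * (1 + 2 / (chainRate 3 κs - chainRate 2 κs)) ^ ν) * ((m : ℝ) * (1 + 2 / (chainRate 2 κs - chainRate 1 κs)) ^ ν)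
      * (θ₀ * (8 / mA) * Kbar
        + Kbar * (8 / mA * θ₀ * ((m : ℝ) * (1 + 2 / (κs - chainRate 4 κs)) ^ ν) * (8 / mA)
            * ((m : ℝ) * (1 + 2 / (chainRate 4 κs - chainRate 3 κs)) ^ ν)) * Kbar
        + Kbar * (8 / mA) * θ₀)
      ≤ theta m ν κs Kbar (8 / mA) θ₀ ∧
    8 / mA * ((m : ℝ) * (1 + 2 / chainRate 3 κs) ^ ν) * (theta m ν κs Kbar (8 / mA) θ₀ * ((m : ℝ) * (1 + 2 / chainRate 1 κs) ^ ν))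
      < 1 ∧
    0 ≤ 2 / mA ∧
    (2 * (theta m ν κs Kbar (8 / mA) θ₀ * ((m : ℝ) * (1 + 2 / chainRate 1 κs) ^ ν))
        + (γ₂ + 2 * ((m' : ℝ) * α₄ * (M ^ 4)⁻¹ * (1 + 32 / (κ₁ - 1)) ^ 4))) * (2 / mA) ≤ 1 / 2 ∧
    (2 * (theta m ν κs Kbar (8 / mA) θ₀ * ((m : ℝ) * (1 + 2 / chainRate 1 κs) ^ ν))
        + (γ₂ + 2 * ((m' : ℝ) * α₄ * (M ^ 4)⁻¹ * (1 + 32 / (κ₁ - 1)) ^ 4)))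
      * (1 + 2 * (2 / mA) * (BΓ * cV * (BΓ * ((m : ℝ) * c0η ^ ν)) / (mA / 2))) ≤ 1 / 2 :=
  numerals_226 m ν m' hκ hKbar (by positivity) hθ₀ (by positivity) hcV hc0 hmA hγ₂ hα₄ hM hθle hγle hM4

end Bundle

end Literature.MathematicalPhysics.QuantumFieldTheory.Balaban1983to89.B13Bound226Numerals

end
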